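import Literature.MathematicalPhysics.QuantumFieldTheory.Balaban1983to89.B9SectCLatticeCurl

/-!
# `Balaban1983to89.B9SectCLatticeOrder` — ORDER BOOKKEEPING for the abstract lattice calculus: the coefficient
# operators of the `hΛ` / `hM` / `hA` shapes are zone-class operators, `Lm₁, Dm₁, Am₁ ∈ 𝒵(−1, ·)` and
# `Lm₀, Dm₀, Am₀ ∈ 𝒵(−2, ·)`, from the two cutoff facts and a frame dominating the bond geometry; and (H) the
# starred operator as a weighted adjoint (D2 of the census, third leaf) — OURS

CITATION HEADER (LEAF RULE: no quotation in this file; pointers BY NAME only).  The published setting is the one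
quoted verbatim in the headers of `…B9SectCDiff` (Balaban, *Commun. Math. Phys.* **99** (1985) 389–434, §C: the
cutoff commutators of the covariant operators are "of order `M⁻¹`" on the proper scale) and `…B9SectCDiffCutModel`
(the cut-model packaging: its fields `modulus`, `zone` are the two cutoff facts used here, in exactly their shapes,
and its fields `zLm₁ … zAm₀` are the CLASS MEMBERSHIPS whose abstract form is proved here); this file adds nothing
from print.  Tree inputs, by name: `B9SectCDiffEstimate.{Frame, Frame.Valid, OpZon, OpZon.of_parts, WDec}` (and the
`Valid` fields `hsc, hu, hδ₀, hρ, sc_zpow_nonneg`); `B9SectCDiffDict.{opZon_of_local, opZon_add, wdec_add}`;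
`B9SectCDiffCutModelToy3.opZon_zero`; `B4Sect5Torus.IsPseudoDist.{symm, triangle}` (through `Valid.hρ`);
`B9SectCLatticeCalc.{IsCarried, ThE, dpart, dpart_apply, Dm₁, Dm₀}`; `B9SectCLatticeCurl.{LmD, LmH, LmN, Lm₀,
isCarried_wadjoint, am₀_exchange}`; for the sanity instance of §6 only: `B9SectCDiffCutModelToy.{dE, bdist,
bdist_self}`, `…Toy2.dE_self`, `…Toy3.{toyFrame, toyFrame_ρ, toyFrame_δ₀, toyFrame_valid}`, `…Toy4.{ι, ι_lt,
exists_succ, bdist_le_one_of_succ, dE_of_succ}`, `B9SectCLatticeCalc.{nxt, nxt_eq_of_succ, nxt_eq_self}`; Mathlib's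
`Matrix.diagonal`, `Matrix.mul_diagonal`, `Matrix.diagonal_mul`, `Matrix.fromCols`, `Matrix.transpose_sum`,
`Matrix.mul_sum`, `Matrix.sum_mul`, `Finset.card_biUnion_le`, `Finset.sum_le_card_nsmul`, `Finset.sum_filter`,
`Finset.abs_sum_le_sum_abs`, `Fintype.sum_prod_type`.  The only import is `…B9SectCLatticeCurl`.

WHAT THIS MODULE DOES (census `SectC-inst-census.md` §7, items (G)/(G′) and (H); claim SECTC-LATTICE-ORDER).  The two
preceding leaves proved the one-sided SHAPES `𝔇(X) = (coefficient)·(h-free carrier) + (remainder)` of the cut model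
as identities (`hM_shape`, `hA_shape`, `hΛ_shape[_parts]`), with coefficients made of FIRST differences of the cutoff
`h` times `h`-free entry tables and remainders made of SECOND differences.  This file supplies the ORDER half: over an
arbitrary valid `Frame` (`B9SectCDiffEstimate`), those coefficient operators belong to the zone classes `𝒵(−1, ·)`
and the remainders to `𝒵(−2, ·)` — the literal types of the `CutModel` fields `zLm₁, zDm₁, zAm₁` / `zLm₀, zDm₀,
zAm₀` — with EXPLICIT constants, from (a) the two cutoff facts in the literal shapes of `CutModel.modulus` /
`CutModel.zone` over a site map `ys : E → S` (instance: `ys = p₁ ∘ blk`), (b) a `Bonds` datum comparing the bond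
geometry with the frame, (c) `(m, c)`-TABLE hypotheses on the `h`-free entry tables ("entries `≤ c`, at most `m` per
row", census (G)), (d) the `IsCarried` supports of the shape files.  The pattern generalised is Toy4 §Classes
(`opZon_Th`, `opZon_transpose_mul_Th`, `opZon_Xi`, `opZon_Lm₁`: `d = 1`, one entry per row, unit tables).
* §1 **ENGINE** over any valid frame: `opZon_local` (≤ `m` entries per row, each `≤ θ₁·sc(row site)ᵏ`, columns
  within frame distance `R`, non-zero only at zone rows ⇒ `𝒵(k, m·θ₁·e^{δ₀R})` — `B9SectCDiffDict.opZon_of_local`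
  with the row site made explicit), `opZon_diagonal`; closure under indexed sums (`opZon_sum`, `opZon_sum_const`),
  under SPREADING a family into column blocks (`spread`, `opZon_spread` — the shape of `LmD`, `LmH`, `LmN`, `Dm₁`)
  and under `Matrix.fromCols` (`opZon_fromCols` — the shape of `Lm₁ = [LmD ∣ LmH ∣ LmN]`).  §1b: the `h`-free
  bookkeeping `IsTab m c A` (count + size; `of_support`, `neg`, `dpart`, `mul`: `A·B` is an `(mm′, m·c·c′)`-table)
  and the three PRODUCT constructors `opZon_mul_diagonal` (table × diagonal, the diagonal factor READ THROUGH THE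
  SUPPORT of the table — on a carried table this ties the column's position to the row's), `opZon_diagonal_mul`,
  `opZon_sandwich` (table × diagonal × table: the shape of every second-order remainder).
* §2 **THE TWO CUTOFF FACTS ON BONDS.**  `Bonds F ys dE ℓ sp tb r R`: every bond `sp p → tb_k p` has position length
  `≤ r` (both orientations — no symmetry of `dE` is assumed), lies within the cutoff's radius `ℓ` of both endpoints,
  and has frame length `≤ R`.  Then a modulus `|g e − g e′| ≤ wt e·dE e e′` within the radius bounds the bond
  difference by `wt·r` with the weight read AT EITHER ENDPOINT (`bond_abs_le`), and the zone fact locates a non-zero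
  bond difference at BOTH endpoint sites (`bond_zone`); `weight₁_eq` / `weight₂_eq` put `ω₀·sc⁻¹·r`, `ω₁·(sc²)⁻¹·r`
  in the `zpow` form of `OpZon`.
* §3 **THE `hΛ` COEFFICIENTS** (setting of `B9SectCLatticeCurl` §2: bonds `xb`, plaquettes `sp`, pair index `K`,
  targets `tb_k`; rows over the row positions' sites EXACTLY, column blocks within frame distance `R₀` of the natural
  site — `R₀ = 0` when they sit over it): `opZon_ThE` (`Θ_k(h) ∈ 𝒵(−1, ω₀r·e^{δ₀R₀})`), `opZon_ThE₂` (`Θ_k(θ_l) ∈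
  𝒵(−2, ω₁r·e^{δ₀R₀})`), `opZon_T'_mul_ThE` / `opZon_J'_mul_ThE` (differences read at the target through `T′_k`, at
  the source through `J′_k`), **`opZon_LmD`** (`𝒵(−1, thLmD)`, `LmD_eq_spread`), **`opZon_LmH`**, **`opZon_LmN`** (hops
  `τ_j` as a `Bonds` datum), **`opZon_Lm₁`** (the total `[LmD ∣ LmH ∣ LmN]` on `Sum.elim` column blocks); §3b
  **`opZon_Lm₀`** (`Σ_kΣ_l T′_k·Θ_k(θ_l)·T_l ∈ 𝒵(−2, thLm₀)`, range `2R + R₀` by the triangle inequality of the frame).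
* §4 **ONE PAIR WITH DIRECTIONS** (setting of `B9SectCLatticeCalc` §§2–3, pair index `Unit` in `Bonds`): **`opZon_Dm₁`**
  (`𝒵(−1)`), **`opZon_Dm₀`** (`Σ_μ Θ_(θ_μ)·(T·T′_μ) ∈ 𝒵(−2, thDm₀)`, via `IsTab.mul`/`.dpart`), **`opZon_Am₁`**
  (`J′Θ_h + T′Θ_h ∈ 𝒵(−1)`), and `Am₀` HONESTLY: by `am₀_exchange`, `Am₀ = diagonal (θ ∘ xs)·(J′J − T′T) + T′·Θ_θ·T`;
  the defect term VANISHES under `hdef` ("`θ = 0` at every site carrying a row of the defect table `J′J − T′T`",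
  `defect_term_eq_zero` — Toy4's `h₄`), whence **`opZon_Am₀`** (`𝒵(−2)`); without `hdef` the defect term is only
  first order (`opZon_Am₀_defect`).
* §5 **(H) ADJOINTNESS.**  For the weighted-adjoint family `T′_k = diagonal w′·T_kᵀ·diagonal w`, `J′_k = diagonal
  w′·J_kᵀ·diagonal w` (any weights: the adjoint of `D = Σ_k (T_k − J_k)` for weighted `ℓ²` products on bonds and
  plaquettes), the four support hypotheses of the shape files FOLLOW from those of `D` (`wadjoint_family_carried`,
  pointwise `isCarried_wadjoint`), `Σ_k (T′_k − J′_k)` IS `diagonal w′·Dᵀ·diagonal w` (`wadjoint_family_sum`), and the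
  adjoint tables are `(m′, W′cW)`-tables from the COLUMN counts of `T_k` (`IsTab.transpose_of_cols`, `IsTab.wadjoint`).
* §6 **SANITY** (`toy_bonds`, `opZon_ThE_toy`): on the toy frame of `…Toy3/Toy4` the bonds `a → nxt a` are a `Bonds`
  datum with `r = R = 1`, and `opZon_ThE` returns `ThE id nxt h ∈ 𝒵(−1, ω₀)` from the two cutoff facts in EXACTLY the
  hypothesis shapes of `B9SectCDiffCutModelToy4.opZon_Th` with the SAME constant `ω₀` (`ThE id nxt h = Th h` is
  `B9SectCLatticeCalc.ThE_toy`) — the general constants do not lose against the hand proof in the diagonal case.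

HONEST CAVEATS.  (1) THE SECOND-DIFFERENCE DATUM IS A HYPOTHESIS: `opZon_ThE₂`, `opZon_Lm₀`, `opZon_Dm₀`, `opZon_Am₀`
take a proper-scale modulus `ω₁·sc⁻²` AND a zone fact for the difference quotients `θ_l` themselves (`hmod₂`,
`hzone₂`, the `CutModel` shapes one order down).  They are NOT consequences of `CutModel.modulus`/`.zone` for `h`
(those give `|θ_l(e) − θ_l(e′)| ≤ 2ω₀r·sc⁻¹`, first order, and no location): a genuinely second-order remainder needs
a `C²`-type cutoff on the proper scale, exactly the datum `hξ` of Toy4's `opZon_Xi`; a lattice `CutModel` instance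
must therefore carry it (for the printed smooth partitions of unity it holds with `ω₁ = O(M⁻²)`).  (2) GLOBAL
FIRST-ORDER FACTS for `LmH`, `Dm₁`, `opZon_Am₀_defect` (`hθb : |θ_l e| ≤ ω₀r·sc(ys e)⁻¹`, `hθz : θ_l e ≠ 0 ⇒ zone`) are
hypotheses on the device functions at ALL positions; where every position is a bond source (a full lattice) they are
`bond_abs_le` / `bond_zone` through `hθ`, in general they are what the device must be chosen to satisfy.  (3) `Am₀ ∈
𝒵(−2)` is CONDITIONAL on `hdef` (unitary transporters, matched weights, `h` locally constant at boundary deletions);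
the analogous issue for `hΛ` sits in the `h`-free ROWS `H_kk` of `Dv` (estimate side, caveat (2) of
`B9SectCLatticeCurl`), not in a coefficient, so no class statement here is conditional on it.  (4) CONSTANTS are
explicit and UNOPTIMISED (`thLmD`, `thLm₀`, `thDm₀` multiply full index counts `|K|`, `|Δ|`, `m` where sharper
support counts would do; ranges are summed, `R + R₀`, `2R + R₀`); only the ORDER `k ∈ {−1, −2}` and the linear
dependence on `ω₀`, `ω₁` matter downstream.  (5) ROWS EXACT, COLUMNS FRAME-CLOSE: row block maps must project to the
row position's site (`pU (bb a) = ys (xb a)` — the `CutModel` convention `bb₁ = blk ∘ xb`), column block maps only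
within `R₀` (the sequence-2 blocks of the two-sequence geometry project elsewhere off the zone, where these operators
vanish anyway).  (6) NO INSTANCE IS BUILT: the D1 carriers, the transporter tables and a `TwoSeq`/`CutModel` term
packaging them remain open (census §5 D1/D2); instantiating this file is substitution (`ys := p₁ ∘ blk`, `hmod :=
X.modulus`, `hzone := X.zone`) plus the `Bonds`/`IsTab` facts of the concrete lattice (`r = R = 1`, `m = 2(d−1)`,
`c = η⁻¹`-weights carried as the scale).  The trace identity (3.8) is a statement about the printed operator,
on the instance side; (H) here is the abstract adjointness only.  (7) Value = located bookkeeping closing census items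
(G) and (H): the `z…` fields of a lattice `CutModel` are now one substitution away from the shape files — NOT summit
progress; no estimate of §C is touched.  Every declaration carries a docstring + `[folklore]` tag; no `sorry`; no
`instance`; no `HarnessLib` fact; standard axioms only.
-/

namespace Literature.MathematicalPhysics.QuantumFieldTheory.Balaban1983to89.B9SectCLatticeOrder

open Finset
open B9SectCDiffEstimate
open B9SectCLatticeCalc (IsCarried ThE dpart dpart_apply Dm₁ Dm₀)
open B9SectCLatticeCurl (LmD LmH Lm₀ LmN isCarried_wadjoint)

noncomputable section

/-! ## §1 Engine and closure constructors over an arbitrary valid frame -/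

section Engine

variable {S : Type*} {F : Frame S}
variable {u v U V : Type*} [Fintype v] [DecidableEq V] {bu : u → U} {bv : v → V} {pU : U → S} {pV : V → S}

/-- `0 ≤ δ₀` for a valid frame (`20u ≤ δ₀`, `0 < u`). [folklore] -/
theorem δ₀_nonneg (hF : F.Valid) : 0 ≤ F.δ₀ := by
  have h1 := hF.hδ₀; have h2 := hF.hu; linarith

/-- **LOCAL-OPERATOR ENGINE over an arbitrary valid frame** (the frame-generic form of
`B9SectCDiffCutModelToy4.opZon_local_toy`): at most `m` non-zero entries per row, each at frame distance `≤ R`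
from the row's site `yu x` (the site over which the row block sits, `hbu`), of size `≤ θ₁·sc(yu x)ᵏ`, on zone rows
⇒ `𝒵(k, m·θ₁·e^{δ₀R})`; the column block map is free. OURS. [folklore] -/
theorem opZon_local (hF : F.Valid) {T : Matrix u v ℝ} {k : ℤ} {θ₁ R : ℝ} {m : ℕ} {yu : u → S} (hθ : 0 ≤ θ₁)
    (hbu : ∀ x, pU (bu x) = yu x) (hcard : ∀ x, (univ.filter fun x' => T x x' ≠ 0).card ≤ m)
    (hR : ∀ x x', T x x' ≠ 0 → F.ρ (yu x) (pV (bv x')) ≤ R)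
    (hsup : ∀ x x', T x x' ≠ 0 → |T x x'| ≤ θ₁ * F.sc (yu x) ^ k)
    (hz : ∀ x x', T x x' ≠ 0 → F.β (yu x) = 0) :
    OpZon F bu bv pU pV k (m * θ₁ * Real.exp (F.δ₀ * R)) T := by
  rw [show (m : ℝ) * θ₁ * Real.exp (F.δ₀ * R) = m * (θ₁ * Real.exp (F.δ₀ * R)) by ring]
  refine B9SectCDiffDict.opZon_of_local hF (by positivity) hcard (fun x x' hT => ?_) (fun x x' hT => ?_)
  · rw [hbu]
    have h2 : F.δ₀ * F.ρ (yu x) (pV (bv x')) ≤ F.δ₀ * R :=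
      mul_le_mul_of_nonneg_left (hR x x' hT) (δ₀_nonneg hF)
    have h3 : (1 : ℝ) ≤ Real.exp (F.δ₀ * R) * Real.exp (-(F.δ₀ * F.ρ (yu x) (pV (bv x')))) := by
      rw [← Real.exp_add]; exact Real.one_le_exp (by linarith)
    calc |T x x'| ≤ θ₁ * F.sc (yu x) ^ k * 1 := by rw [mul_one]; exact hsup x x' hT
      _ ≤ θ₁ * F.sc (yu x) ^ k * (Real.exp (F.δ₀ * R) * Real.exp (-(F.δ₀ * F.ρ (yu x) (pV (bv x'))))) :=
          mul_le_mul_of_nonneg_left h3 (mul_nonneg hθ (hF.sc_zpow_nonneg k _))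
      _ = θ₁ * Real.exp (F.δ₀ * R) * F.sc (yu x) ^ k * Real.exp (-(F.δ₀ * F.ρ (yu x) (pV (bv x')))) := by
          ring
  · rw [hbu]; exact hz x x' hT

/-- **DIAGONAL operators**: `diagonal d ∈ 𝒵(k, θ₁·e^{δ₀R})` if `|d x| ≤ θ₁·sc(yu x)ᵏ` on its support, the support
rows are zone rows, and the column block of `x` is within frame distance `R` of `yu x`. OURS. [folklore] -/
theorem opZon_diagonal [Fintype u] [DecidableEq u] (hF : F.Valid) {bv : u → V}
    {d : u → ℝ} {k : ℤ} {θ₁ R : ℝ} {yu : u → S}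
    (hθ : 0 ≤ θ₁) (hbu : ∀ x, pU (bu x) = yu x) (hR : ∀ x, d x ≠ 0 → F.ρ (yu x) (pV (bv x)) ≤ R)
    (hsup : ∀ x, d x ≠ 0 → |d x| ≤ θ₁ * F.sc (yu x) ^ k) (hz : ∀ x, d x ≠ 0 → F.β (yu x) = 0) :
    OpZon F bu bv pU pV k (θ₁ * Real.exp (F.δ₀ * R)) (Matrix.diagonal d) := by
  have key : ∀ x x', Matrix.diagonal d x x' ≠ 0 → x = x' ∧ d x ≠ 0 := fun x x' h => by
    by_cases hxx : x = x'
    · subst hxx; rw [Matrix.diagonal_apply_eq] at h; exact ⟨rfl, h⟩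
    · exact absurd (Matrix.diagonal_apply_ne _ hxx) h
  rw [show θ₁ * Real.exp (F.δ₀ * R) = ((1 : ℕ) : ℝ) * θ₁ * Real.exp (F.δ₀ * R) by rw [Nat.cast_one, one_mul]]
  refine opZon_local hF hθ hbu (fun x => ?_) (fun x x' hT => ?_) (fun x x' hT => ?_) (fun x x' hT => ?_)
  · refine card_le_one.2 fun a ha b hb => ?_
    rw [mem_filter] at ha hb
    rw [← (key x a ha.2).1, ← (key x b hb.2).1]
  · obtain ⟨rfl, hd⟩ := key x x' hT; exact hR x hd
  · obtain ⟨rfl, hd⟩ := key x x' hT; rw [Matrix.diagonal_apply_eq]; exact hsup x hd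
  · obtain ⟨rfl, hd⟩ := key x x' hT; exact hz x hd

/-- `𝒵` of a finite sum: `Σ_{i ∈ s} Z_i ∈ 𝒵(k, Σ_{i ∈ s} θ_i)`. [folklore] -/
theorem opZon_sum {ι : Type*} (s : Finset ι) {k : ℤ} {θ : ι → ℝ} {Z : ι → Matrix u v ℝ}
    (h : ∀ i ∈ s, OpZon F bu bv pU pV k (θ i) (Z i)) :
    OpZon F bu bv pU pV k (∑ i ∈ s, θ i) (∑ i ∈ s, Z i) := by
  induction s using Finset.cons_induction with
  | empty => rw [sum_empty, sum_empty]; exact B9SectCDiffCutModelToy3.opZon_zero F bu bv pU pV k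
  | cons a s ha ih =>
    rw [sum_cons, sum_cons]
    exact B9SectCDiffDict.opZon_add (h a (mem_cons_self a s)) (ih fun i hi => h i (mem_cons.2 (Or.inr hi)))

/-- `𝒵` of a finite sum with a common constant: `Σ_i Z_i ∈ 𝒵(k, |ι|·θ)`. [folklore] -/
theorem opZon_sum_const {ι : Type*} [Fintype ι] {k : ℤ} {θ : ℝ} {Z : ι → Matrix u v ℝ}
    (h : ∀ i, OpZon F bu bv pU pV k θ (Z i)) : OpZon F bu bv pU pV k (Fintype.card ι * θ) (∑ i, Z i) := by
  have h1 := opZon_sum (F := F) (bu := bu) (bv := bv) (pU := pU) (pV := pV) univ fun i _ => h i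
  rwa [sum_const, card_univ, nsmul_eq_mul] at h1

/-- SPREADING a family of operators over a finite column index: `spread Z (x, (i, x′)) = Z_i(x, x′)`.
OURS (typing). [folklore] -/
def spread {ι : Type*} (Z : ι → Matrix u v ℝ) : Matrix u (ι × v) ℝ := Matrix.of fun x q => Z q.1 x q.2

omit [Fintype v] in
/-- [folklore] -/
theorem spread_apply {ι : Type*} (Z : ι → Matrix u v ℝ) (x : u) (q : ι × v) : spread Z x q = Z q.1 x q.2 := rfl

/-- **`𝒵` is closed under spreading**: if every `Z_i ∈ 𝒵(k, θ)` for the column block map `x′ ↦ bq (i, x′)`, then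
`spread Z ∈ 𝒵(k, |ι|·θ)` for `bq` (majorant = the sum of the majorants). [folklore] -/
theorem opZon_spread {ι : Type*} [Fintype ι] {k : ℤ} {θ : ℝ} {Z : ι → Matrix u v ℝ} {bq : ι × v → V}
    (h : ∀ i, OpZon F bu (fun x' => bq (i, x')) pU pV k θ (Z i)) :
    OpZon F bu bq pU pV k (Fintype.card ι * θ) (spread Z) := by
  classical
  choose K hB hW hR using h
  refine OpZon.of_parts (K := ∑ i, K i) ⟨fun I J => ?_, fun x J => ?_⟩ (fun I J => ?_) fun I J hne => ?_
  · rw [Matrix.sum_apply]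
    exact sum_nonneg fun i _ => (hB i).nonneg I J
  · rw [Matrix.sum_apply]
    calc ∑ q ∈ univ.filter (fun q => bq q = J), |spread Z x q|
        = ∑ i, ∑ x' ∈ univ.filter (fun x' => bq (i, x') = J), |Z i x x'| := by
          rw [sum_filter, Fintype.sum_prod_type]
          exact sum_congr rfl fun i _ => by rw [sum_filter]; rfl
      _ ≤ ∑ i, K i (bu x) J := sum_le_sum fun i _ => (hB i).le x J
  · rw [Matrix.sum_apply]
    calc |∑ i, K i I J| ≤ ∑ i, |K i I J| := abs_sum_le_sum_abs _ _
      _ ≤ ∑ _i : ι, θ * F.sc (pU I) ^ k * Real.exp (-(F.rate 0 * F.ρ (pU I) (pV J))) :=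
          sum_le_sum fun i _ => hW i I J
      _ = Fintype.card ι * θ * F.sc (pU I) ^ k * Real.exp (-(F.rate 0 * F.ρ (pU I) (pV J))) := by
          rw [sum_const, card_univ, nsmul_eq_mul]; ring
  · rw [Matrix.sum_apply] at hne
    obtain ⟨i, -, hi⟩ := exists_ne_zero_of_sum_ne_zero hne
    exact hR i I J hi

/-- **`𝒵` is closed under column stacking**: `fromCols Z₁ Z₂ ∈ 𝒵(k, θ₁ + θ₂)` for the column block map
`Sum.elim bv₁ bv₂` (the coefficient `Lm₁ = [LmD ∣ LmH ∣ LmN]` of `B9SectCLatticeCurl.hΛ_shape_parts` is such a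
stacking). [folklore] -/
theorem opZon_fromCols {v₁ v₂ : Type*} [Fintype v₁] [Fintype v₂] {bv₁ : v₁ → V} {bv₂ : v₂ → V} {k : ℤ}
    {θ₁ θ₂ : ℝ} {Z₁ : Matrix u v₁ ℝ} {Z₂ : Matrix u v₂ ℝ} (h₁ : OpZon F bu bv₁ pU pV k θ₁ Z₁)
    (h₂ : OpZon F bu bv₂ pU pV k θ₂ Z₂) :
    OpZon F bu (Sum.elim bv₁ bv₂) pU pV k (θ₁ + θ₂) (Matrix.fromCols Z₁ Z₂) := by
  classical
  obtain ⟨K₁, hB₁, hW₁, hR₁⟩ := h₁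
  obtain ⟨K₂, hB₂, hW₂, hR₂⟩ := h₂
  refine OpZon.of_parts (K := K₁ + K₂) ⟨fun I J => ?_, fun x J => ?_⟩ (B9SectCDiffDict.wdec_add hW₁ hW₂)
    fun I J hne => ?_
  · rw [Matrix.add_apply]; exact add_nonneg (hB₁.nonneg I J) (hB₂.nonneg I J)
  · rw [Matrix.add_apply]
    have hsplit : univ.filter (fun q : v₁ ⊕ v₂ => Sum.elim bv₁ bv₂ q = J) =
        (univ.filter (fun x' => bv₁ x' = J)).map Function.Embedding.inl ∪
          (univ.filter (fun x' => bv₂ x' = J)).map Function.Embedding.inr := by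
      ext q
      rcases q with x' | x' <;> simp
    rw [hsplit, sum_union (by
      rw [disjoint_left]
      intro q h1 h2
      rw [mem_map] at h1 h2
      obtain ⟨a, -, rfl⟩ := h1
      obtain ⟨b, -, hb⟩ := h2
      exact Sum.inr_ne_inl hb), sum_map, sum_map]
    simp only [Function.Embedding.inl_apply, Function.Embedding.inr_apply, Matrix.fromCols_apply_inl,
      Matrix.fromCols_apply_inr]
    exact add_le_add (hB₁.le x J) (hB₂.le x J)
  · by_cases hz : K₁ I J = 0
    · have hz₂ : K₂ I J ≠ 0 := by
        intro hz₂; apply hne; rw [Matrix.add_apply, hz, hz₂, add_zero]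
      exact hR₂ I J hz₂
    · exact hR₁ I J hz

/-! ### §1b `h`-free table bookkeeping and the three product constructors -/

/-- an **`(m, c)`-TABLE**: at most `m` non-zero entries per row, every entry of size `≤ c` — the `h`-free datum of
the transporter / inclusion tables `T_k, J_k, T′_k, J′_k` of the lattice calculus (census §7 (G): *"entries bounded
by `c_T`, at most `m` per row"*). OURS (typing). [folklore] -/
structure IsTab {w : Type*} [Fintype w] (m : ℕ) (c : ℝ) (A : Matrix u w ℝ) : Prop where
  /-- locality count -/
  count : ∀ x, (univ.filter fun y => A x y ≠ 0).card ≤ m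
  /-- entrywise size -/
  size : ∀ x y, |A x y| ≤ c

omit [Fintype v] [DecidableEq V] in
/-- a non-zero entry of a product has a non-zero two-step path. [folklore] -/
theorem exists_of_mul_ne_zero {w : Type*} [Fintype w] {A : Matrix u w ℝ} {B : Matrix w v ℝ} {x : u} {z : v}
    (h : (A * B) x z ≠ 0) : ∃ y, A x y ≠ 0 ∧ B y z ≠ 0 := by
  rw [Matrix.mul_apply] at h
  obtain ⟨y, -, hy⟩ := exists_ne_zero_of_sum_ne_zero h
  exact ⟨y, left_ne_zero_of_mul hy, right_ne_zero_of_mul hy⟩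

namespace IsTab

variable {w : Type*} [Fintype w] {m m' : ℕ} {c c' : ℝ} {A : Matrix u w ℝ}

omit [Fintype v] in
/-- a table with smaller support and entries `≤ c′` is an `(m, c′)`-table. [folklore] -/
theorem of_support {B : Matrix u w ℝ} (hA : IsTab m c A) (hB : ∀ x y, B x y ≠ 0 → A x y ≠ 0)
    (hBs : ∀ x y, |B x y| ≤ c') : IsTab m c' B where
  count x := by
    classical
    exact (card_le_card (fun y hy => by
      rw [mem_filter] at hy ⊢; exact ⟨hy.1, hB x y hy.2⟩)).trans (hA.count x)
  size := hBs

omit [Fintype v] in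
/-- [folklore] -/
theorem neg (hA : IsTab m c A) : IsTab m c (-A) :=
  hA.of_support (fun x y h => by rwa [Matrix.neg_apply, neg_ne_zero] at h) fun x y => by
    rw [Matrix.neg_apply, abs_neg]; exact hA.size x y

omit [Fintype v] in
/-- a direction part of a table is a table. [folklore] -/
theorem dpart {Δ : Type*} [DecidableEq Δ] (hA : IsTab m c A) (dir : w → Δ) (μ : Δ) (hc : 0 ≤ c) :
    IsTab m c (dpart dir μ A) :=
  hA.of_support (fun x y h => by
    rw [dpart_apply] at h
    by_cases hy : dir y = μ
    · rwa [if_pos hy] at h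
    · exact absurd (if_neg hy) h) fun x y => by
    rw [dpart_apply]
    by_cases hy : dir y = μ
    · rw [if_pos hy]; exact hA.size x y
    · rw [if_neg hy, abs_zero]; exact hc

/-- **product of tables**: `A·B` is an `(m·m′, m·c·c′)`-table. [folklore] -/
theorem mul [DecidableEq w] {B : Matrix w v ℝ} (hA : IsTab m c A) (hB : IsTab m' c' B) (hc : 0 ≤ c)
    (hc' : 0 ≤ c') : IsTab (m * m') (m * (c * c')) (A * B) where
  count x := by
    classical
    have hsub : univ.filter (fun z => (A * B) x z ≠ 0) ⊆
        (univ.filter fun y => A x y ≠ 0).biUnion fun y => univ.filter fun z => B y z ≠ 0 := by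
      intro z hz
      rw [mem_filter] at hz
      rw [mem_biUnion]
      rw [Matrix.mul_apply] at hz
      obtain ⟨y, -, hy⟩ := exists_ne_zero_of_sum_ne_zero hz.2
      exact ⟨y, mem_filter.2 ⟨mem_univ _, left_ne_zero_of_mul hy⟩,
        mem_filter.2 ⟨mem_univ _, right_ne_zero_of_mul hy⟩⟩
    calc (univ.filter fun z => (A * B) x z ≠ 0).card
        ≤ ((univ.filter fun y => A x y ≠ 0).biUnion fun y => univ.filter fun z => B y z ≠ 0).card :=
          card_le_card hsub
      _ ≤ ∑ y ∈ univ.filter (fun y => A x y ≠ 0), (univ.filter fun z => B y z ≠ 0).card := card_biUnion_le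
      _ ≤ (univ.filter fun y => A x y ≠ 0).card * m' := by
          rw [← smul_eq_mul]; exact sum_le_card_nsmul _ _ _ fun y _ => hB.count y
      _ ≤ m * m' := Nat.mul_le_mul_right _ (hA.count x)
  size x z := by
    classical
    rw [Matrix.mul_apply]
    have h1 : ∑ y, A x y * B y z = ∑ y ∈ univ.filter (fun y => A x y ≠ 0), A x y * B y z := by
      rw [sum_filter]
      exact sum_congr rfl fun y _ => by
        by_cases h0 : A x y ≠ 0
        · rw [if_pos h0]
        · rw [if_neg h0, not_ne_iff.1 h0, zero_mul]
    rw [h1]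
    calc |∑ y ∈ univ.filter (fun y => A x y ≠ 0), A x y * B y z|
        ≤ ∑ y ∈ univ.filter (fun y => A x y ≠ 0), |A x y * B y z| := abs_sum_le_sum_abs _ _
      _ ≤ ∑ _y ∈ univ.filter (fun y => A x y ≠ 0), c * c' := sum_le_sum fun y _ => by
          rw [abs_mul]; exact mul_le_mul (hA.size x y) (hB.size y z) (abs_nonneg _) hc
      _ = (univ.filter fun y => A x y ≠ 0).card * (c * c') := by rw [sum_const, nsmul_eq_mul]
      _ ≤ m * (c * c') := mul_le_mul_of_nonneg_right (Nat.cast_le.2 (hA.count x)) (mul_nonneg hc hc')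

end IsTab

variable {w : Type*} [Fintype w] [DecidableEq w]

/-- **TABLE × DIAGONAL**: `A·diagonal d ∈ 𝒵(k, m·c·ω·e^{δ₀R})` for an `(m, c)`-table `A` when, READ THROUGH THE
SUPPORT OF `A` (row `x` sees `d y` only if `A x y ≠ 0` — on a carried table this ties `y`'s position to `x`'s), the
diagonal factor is `≤ ω·sc(yu x)ᵏ`, non-zero only at zone rows, and the columns are within frame distance `R`.
OURS. [folklore] -/
theorem opZon_mul_diagonal (hF : F.Valid) {A : Matrix u v ℝ} [DecidableEq v] {d : v → ℝ} {m : ℕ} {c ω R : ℝ}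
    {k : ℤ} {yu : u → S} (hA : IsTab m c A) (hc : 0 ≤ c) (hω : 0 ≤ ω) (hbu : ∀ x, pU (bu x) = yu x)
    (hd : ∀ x y, A x y ≠ 0 → |d y| ≤ ω * F.sc (yu x) ^ k)
    (hz : ∀ x y, A x y ≠ 0 → d y ≠ 0 → F.β (yu x) = 0)
    (hR : ∀ x y, A x y ≠ 0 → d y ≠ 0 → F.ρ (yu x) (pV (bv y)) ≤ R) :
    OpZon F bu bv pU pV k (m * (c * ω) * Real.exp (F.δ₀ * R)) (A * Matrix.diagonal d) := by
  have hne : ∀ x y, (A * Matrix.diagonal d) x y ≠ 0 → A x y ≠ 0 ∧ d y ≠ 0 := fun x y h => by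
    rw [Matrix.mul_diagonal] at h; exact ⟨left_ne_zero_of_mul h, right_ne_zero_of_mul h⟩
  refine opZon_local hF (mul_nonneg hc hω) hbu (fun x => ?_) (fun x y h => ?_) (fun x y h => ?_) (fun x y h => ?_)
  · classical
    exact (card_le_card fun y hy => by
      rw [mem_filter] at hy ⊢; exact ⟨hy.1, (hne x y hy.2).1⟩).trans (hA.count x)
  · exact hR x y (hne x y h).1 (hne x y h).2
  · rw [Matrix.mul_diagonal, abs_mul]
    calc |A x y| * |d y| ≤ c * (ω * F.sc (yu x) ^ k) :=
          mul_le_mul (hA.size x y) (hd x y (hne x y h).1) (abs_nonneg _) hc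
      _ = c * ω * F.sc (yu x) ^ k := by ring
  · exact hz x y (hne x y h).1 (hne x y h).2

/-- **DIAGONAL × TABLE**: `diagonal d·B ∈ 𝒵(k, m·ω·c·e^{δ₀R})` for an `(m, c)`-table `B` when `|d x| ≤ ω·sc(yu x)ᵏ`,
`d` is supported on zone rows and the columns of `B` are within frame distance `R` of the row's site. OURS.
[folklore] -/
theorem opZon_diagonal_mul [Fintype u] [DecidableEq u] (hF : F.Valid) {B : Matrix u v ℝ} {d : u → ℝ} {m : ℕ}
    {c ω R : ℝ} {k : ℤ} {yu : u → S} (hB : IsTab m c B) (hc : 0 ≤ c) (hω : 0 ≤ ω) (hbu : ∀ x, pU (bu x) = yu x)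
    (hd : ∀ x, d x ≠ 0 → |d x| ≤ ω * F.sc (yu x) ^ k) (hz : ∀ x, d x ≠ 0 → F.β (yu x) = 0)
    (hR : ∀ x y, d x ≠ 0 → B x y ≠ 0 → F.ρ (yu x) (pV (bv y)) ≤ R) :
    OpZon F bu bv pU pV k (m * (ω * c) * Real.exp (F.δ₀ * R)) (Matrix.diagonal d * B) := by
  have hne : ∀ x y, (Matrix.diagonal d * B) x y ≠ 0 → d x ≠ 0 ∧ B x y ≠ 0 := fun x y h => by
    rw [Matrix.diagonal_mul] at h; exact ⟨left_ne_zero_of_mul h, right_ne_zero_of_mul h⟩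
  refine opZon_local hF (mul_nonneg hω hc) hbu (fun x => ?_) (fun x y h => ?_) (fun x y h => ?_) (fun x y h => ?_)
  · classical
    exact (card_le_card fun y hy => by
      rw [mem_filter] at hy ⊢; exact ⟨hy.1, (hne x y hy.2).2⟩).trans (hB.count x)
  · exact hR x y (hne x y h).1 (hne x y h).2
  · rw [Matrix.diagonal_mul, abs_mul]
    calc |d x| * |B x y| ≤ ω * F.sc (yu x) ^ k * c :=
          mul_le_mul (hd x (hne x y h).1) (hB.size x y) (abs_nonneg _) (mul_nonneg hω (hF.sc_zpow_nonneg k _))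
      _ = ω * c * F.sc (yu x) ^ k := by ring
  · exact hz x (hne x y h).1

/-- **TABLE × DIAGONAL × TABLE** (the shape of the second-order remainders `T′_k·Θ_k(θ_l)·T_l` of
`B9SectCLatticeCurl.Lm₀` and `T′·Θ_θ·T` of `B9SectCLatticeCurl.am₀_exchange`): for an `(m, c)`-table `A` and an
`(m′, c′)`-table `B`, `A·diagonal d·B ∈ 𝒵(k, (m·m′)·(m·c·ω·c′)·e^{δ₀R})` when the middle factor, read through the
support of `A`, is `≤ ω·sc(yu x)ᵏ` and non-zero only at zone rows, and the two-step columns are within frame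
distance `R`. OURS. [folklore] -/
theorem opZon_sandwich (hF : F.Valid) {A : Matrix u w ℝ} {B : Matrix w v ℝ} {d : w → ℝ} {m m' : ℕ}
    {c c' ω R : ℝ} {k : ℤ} {yu : u → S} (hA : IsTab m c A) (hB : IsTab m' c' B) (hc : 0 ≤ c) (hc' : 0 ≤ c')
    (hω : 0 ≤ ω) (hbu : ∀ x, pU (bu x) = yu x) (hd : ∀ x y, A x y ≠ 0 → |d y| ≤ ω * F.sc (yu x) ^ k)
    (hz : ∀ x y, A x y ≠ 0 → d y ≠ 0 → F.β (yu x) = 0)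
    (hR : ∀ x y z, A x y ≠ 0 → B y z ≠ 0 → F.ρ (yu x) (pV (bv z)) ≤ R) :
    OpZon F bu bv pU pV k ((m * m' : ℕ) * (m * (c * ω * c')) * Real.exp (F.δ₀ * R))
      (A * Matrix.diagonal d * B) := by
  classical
  -- `A·diagonal d` is an `(m, c·ω′)`-table?  No: its entries carry the scale; count and support suffice.
  have hAD : ∀ x y, (A * Matrix.diagonal d) x y = A x y * d y := fun x y => Matrix.mul_diagonal _ _ _ _
  have hne : ∀ x z, (A * Matrix.diagonal d * B) x z ≠ 0 → ∃ y, A x y ≠ 0 ∧ d y ≠ 0 ∧ B y z ≠ 0 := by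
    intro x z h
    rw [Matrix.mul_apply] at h
    obtain ⟨y, -, hy⟩ := exists_ne_zero_of_sum_ne_zero h
    rw [hAD] at hy
    exact ⟨y, left_ne_zero_of_mul (left_ne_zero_of_mul hy), right_ne_zero_of_mul (left_ne_zero_of_mul hy),
      right_ne_zero_of_mul hy⟩
  refine opZon_local hF (by positivity) hbu (fun x => ?_) (fun x z h => ?_) (fun x z h => ?_) (fun x z h => ?_)
  · have hsub : univ.filter (fun z => (A * Matrix.diagonal d * B) x z ≠ 0) ⊆
        (univ.filter fun y => A x y ≠ 0).biUnion fun y => univ.filter fun z => B y z ≠ 0 := by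
      intro z hz
      rw [mem_filter] at hz
      obtain ⟨y, hy, -, hyz⟩ := hne x z hz.2
      exact mem_biUnion.2 ⟨y, mem_filter.2 ⟨mem_univ _, hy⟩, mem_filter.2 ⟨mem_univ _, hyz⟩⟩
    calc (univ.filter fun z => (A * Matrix.diagonal d * B) x z ≠ 0).card
        ≤ ((univ.filter fun y => A x y ≠ 0).biUnion fun y => univ.filter fun z => B y z ≠ 0).card :=
          card_le_card hsub
      _ ≤ ∑ y ∈ univ.filter (fun y => A x y ≠ 0), (univ.filter fun z => B y z ≠ 0).card := card_biUnion_le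
      _ ≤ (univ.filter fun y => A x y ≠ 0).card * m' := by
          rw [← smul_eq_mul]; exact sum_le_card_nsmul _ _ _ fun y _ => hB.count y
      _ ≤ m * m' := Nat.mul_le_mul_right _ (hA.count x)
  · obtain ⟨y, hy, -, hyz⟩ := hne x z h
    exact hR x y z hy hyz
  · rw [Matrix.mul_apply]
    have h1 : ∑ y, (A * Matrix.diagonal d) x y * B y z =
        ∑ y ∈ univ.filter (fun y => A x y ≠ 0), A x y * d y * B y z := by
      rw [sum_filter]
      exact sum_congr rfl fun y _ => by
        rw [hAD]
        by_cases h0 : A x y ≠ 0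
        · rw [if_pos h0]
        · rw [if_neg h0, not_ne_iff.1 h0, zero_mul, zero_mul]
    rw [h1]
    calc |∑ y ∈ univ.filter (fun y => A x y ≠ 0), A x y * d y * B y z|
        ≤ ∑ y ∈ univ.filter (fun y => A x y ≠ 0), |A x y * d y * B y z| := abs_sum_le_sum_abs _ _
      _ ≤ ∑ _y ∈ univ.filter (fun y => A x y ≠ 0), c * (ω * F.sc (yu x) ^ k) * c' :=
          sum_le_sum fun y hy => by
            rw [abs_mul, abs_mul]
            have hy' := (mem_filter.1 hy).2
            exact mul_le_mul (mul_le_mul (hA.size x y) (hd x y hy') (abs_nonneg _) hc) (hB.size y z)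
              (abs_nonneg _) (mul_nonneg hc (mul_nonneg hω (hF.sc_zpow_nonneg k _)))
      _ = (univ.filter fun y => A x y ≠ 0).card * (c * (ω * F.sc (yu x) ^ k) * c') := by
          rw [sum_const, nsmul_eq_mul]
      _ ≤ m * (c * (ω * F.sc (yu x) ^ k) * c') :=
          mul_le_mul_of_nonneg_right (Nat.cast_le.2 (hA.count x))
            (mul_nonneg (mul_nonneg hc (mul_nonneg hω (hF.sc_zpow_nonneg k _))) hc')
      _ = m * (c * ω * c') * F.sc (yu x) ^ k := by ring
  · obtain ⟨y, hy, hdy, -⟩ := hne x z h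
    exact hz x y hy hdy


end Engine

/-- transporting the constant of a `𝒵`-membership along an equality of reals. [folklore] -/
theorem opZon_cst {S u v U V : Type*} [Fintype v] [DecidableEq V] {F : Frame S} {bu : u → U} {bv : v → V}
    {pU : U → S} {pV : V → S} {k : ℤ} {θ θ' : ℝ} {Z : Matrix u v ℝ} (h : OpZon F bu bv pU pV k θ Z)
    (e : θ = θ') : OpZon F bu bv pU pV k θ' Z := e ▸ h

/-! ## §2 The two cutoff facts, read on bonds -/

section BondFacts

variable {S E P K : Type*} {F : Frame S} {ys : E → S} {dE : E → E → ℝ} {ℓ : E → ℝ} {sp : P → E}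
  {tb : K → P → E} {r R : ℝ}

/-- **BONDS vs THE FRAME** — the only geometry the order bookkeeping uses: every bond `sp p → tb_k p` has
position-length `≤ r` in both orientations, lies within the cutoff's locality radius `ℓ` of both its endpoints,
and has FRAME-length `≤ R` between the sites `ys` of its endpoints ("the frame distance dominates the position
metric", census §7 (G)); `0 ≤ r`, `0 ≤ R`.  On the unit lattice with blocks of `≥ 1` sites: `r = 1`, `R = 1`.
No axiom on `dE`.  OURS (typing). [folklore] -/
structure Bonds (F : Frame S) (ys : E → S) (dE : E → E → ℝ) (ℓ : E → ℝ) (sp : P → E) (tb : K → P → E)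
    (r R : ℝ) : Prop where
  /-- the two lengths are non-negative -/
  r_nonneg : 0 ≤ r
  R_nonneg : 0 ≤ R
  /-- position length, both orientations -/
  len_s : ∀ k p, dE (sp p) (tb k p) ≤ r
  len_t : ∀ k p, dE (tb k p) (sp p) ≤ r
  /-- within the cutoff's radius at both endpoints -/
  loc_s : ∀ k p, dE (sp p) (tb k p) ≤ ℓ (sp p)
  loc_t : ∀ k p, dE (tb k p) (sp p) ≤ ℓ (tb k p)
  /-- frame length -/
  frm : ∀ k p, F.ρ (ys (sp p)) (ys (tb k p)) ≤ R

/-- **MODULUS ON A BOND, AT EITHER ENDPOINT**: a proper-scale modulus of `g` within the radius (the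
`CutModel.modulus` shape with weight `wt e`, e.g. `wt e = ω₀·sc(ys e)⁻¹`) bounds the bond difference by `wt·r` with the
weight read at the SOURCE and at the TARGET. [folklore] -/
theorem bond_abs_le {g wt : E → ℝ} (hmod : ∀ e e', dE e e' ≤ ℓ e → |g e - g e'| ≤ wt e * dE e e')
    (hwt : ∀ e, 0 ≤ wt e) (hb : Bonds F ys dE ℓ sp tb r R) (k : K) (p : P) :
    |g (tb k p) - g (sp p)| ≤ wt (sp p) * r ∧ |g (tb k p) - g (sp p)| ≤ wt (tb k p) * r := by
  constructor
  · rw [abs_sub_comm]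
    exact (hmod _ _ (hb.loc_s k p)).trans (mul_le_mul_of_nonneg_left (hb.len_s k p) (hwt _))
  · exact (hmod _ _ (hb.loc_t k p)).trans (mul_le_mul_of_nonneg_left (hb.len_t k p) (hwt _))

/-- **ZONE LOCATION OF A BOND, AT EITHER ENDPOINT**: if `g` differs along a bond then (the `CutModel.zone` shape)
both endpoints' sites are zone sites. [folklore] -/
theorem bond_zone {g : E → ℝ} (hzone : ∀ e e', dE e e' ≤ ℓ e → g e ≠ g e' → F.β (ys e) = 0)
    (hb : Bonds F ys dE ℓ sp tb r R) {k : K} {p : P} (hne : g (tb k p) ≠ g (sp p)) :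
    F.β (ys (sp p)) = 0 ∧ F.β (ys (tb k p)) = 0 :=
  ⟨hzone _ _ (hb.loc_s k p) hne.symm, hzone _ _ (hb.loc_t k p) hne⟩

/-- the first-order weight in `zpow` form: `ω₀·sc⁻¹·r = (ω₀r)·sc^(−1)`. [folklore] -/
theorem weight₁_eq (ω₀ r a : ℝ) : ω₀ * a⁻¹ * r = ω₀ * r * a ^ (-1 : ℤ) := by
  rw [zpow_neg_one]; ring

/-- the second-order weight in `zpow` form: `ω₁·(sc²)⁻¹·r = (ω₁r)·sc^(−2)`. [folklore] -/
theorem weight₂_eq (ω₁ r a : ℝ) : ω₁ * (a ^ 2)⁻¹ * r = ω₁ * r * a ^ (-2 : ℤ) := by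
  rw [show (-2 : ℤ) = -((2 : ℕ) : ℤ) by norm_num, zpow_neg, zpow_natCast]; ring

/-- frame length of a bond read from the target. [folklore] -/
theorem Bonds.frm' (hF : F.Valid) (hb : Bonds F ys dE ℓ sp tb r R) (k : K) (p : P) :
    F.ρ (ys (tb k p)) (ys (sp p)) ≤ R := by
  rw [hF.hρ.symm]; exact hb.frm k p

/-- two bonds of one plaquette: frame distance `≤ 2R` between their targets. [folklore] -/
theorem Bonds.frm₂ (hF : F.Valid) (hb : Bonds F ys dE ℓ sp tb r R) (k l : K) (p : P) :
    F.ρ (ys (tb k p)) (ys (tb l p)) ≤ 2 * R :=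
  calc F.ρ (ys (tb k p)) (ys (tb l p)) ≤ F.ρ (ys (tb k p)) (ys (sp p)) + F.ρ (ys (sp p)) (ys (tb l p)) :=
        hF.hρ.triangle _ _ _
    _ ≤ R + R := add_le_add (hb.frm' hF k p) (hb.frm l p)
    _ = 2 * R := by ring

end BondFacts

/-! ## §3 The coefficient operators of the Leibniz shapes -/

section Pairs

variable {S E b P K U V : Type*} [Fintype b] [Fintype P] [DecidableEq b] [DecidableEq P] [Fintype K]
  [DecidableEq K] [DecidableEq V]
variable {F : Frame S} {ys : E → S} {dE : E → E → ℝ} {ℓ : E → ℝ} {h : E → ℝ} {θs : K → E → ℝ}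
  {ω₀ ω₁ r R R₀ cT cJ cT' cJ' : ℝ} {m : ℕ}
variable {xb : b → E} {sp : P → E} {tb : K → P → E}
variable {T J : K → Matrix P b ℝ} {T' J' : K → Matrix b P ℝ}
variable {pU : U → S} {pV : V → S}

omit [Fintype K] [DecidableEq K] in
/-- **`Θ_k(h) = ThE sp tb_k h ∈ 𝒵(−1, ω₀r·e^{δ₀R₀})`**: the diagonal of the first differences of the cutoff along
the `k`-bonds, from the two cutoff facts in their `CutModel` shapes (`ys` = the site map `p₁ ∘ blk`) and the bond
geometry; rows over the plaquette sites exactly (`hbP`), columns within frame distance `R₀` (`hbP′`; `R₀ = 0` when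
the column blocks sit over the same sites).  The frame-generic form of `B9SectCDiffCutModelToy4.opZon_Th`.  OURS.
[folklore] -/
theorem opZon_ThE (hF : F.Valid) {bP : P → U} {bP' : P → V} (hω₀ : 0 ≤ ω₀)
    (hmod : ∀ e e', dE e e' ≤ ℓ e → |h e - h e'| ≤ ω₀ * (F.sc (ys e))⁻¹ * dE e e')
    (hzone : ∀ e e', dE e e' ≤ ℓ e → h e ≠ h e' → F.β (ys e) = 0) (hb : Bonds F ys dE ℓ sp tb r R)
    (hbP : ∀ p, pU (bP p) = ys (sp p)) (hbP' : ∀ p, F.ρ (ys (sp p)) (pV (bP' p)) ≤ R₀) (k : K) :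
    OpZon F bP bP' pU pV (-1) (ω₀ * r * Real.exp (F.δ₀ * R₀)) (ThE sp (tb k) h) := by
  rw [ThE]
  refine opZon_diagonal hF (mul_nonneg hω₀ hb.r_nonneg) hbP (fun p _ => hbP' p) (fun p _ => ?_)
    fun p hp => (bond_zone hzone hb (sub_ne_zero.1 hp)).1
  rw [← weight₁_eq]
  exact (bond_abs_le hmod (fun e => mul_nonneg hω₀ (inv_nonneg.2 (hF.hsc _).le)) hb k p).1

omit [Fintype K] [DecidableEq K] in
/-- **`Θ_k(θ_l) = ThE sp tb_k (θ_l) ∈ 𝒵(−2, ω₁r·e^{δ₀R₀})`** — the diagonal of the SECOND differences — GIVEN the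
proper-scale modulus `ω₁·sc⁻²` and the zone fact for the difference quotients `θ_l` themselves (the `CutModel` shapes
one order down; a datum on `h` BEYOND `CutModel.modulus`, exactly as the hypothesis `hξ` of
`B9SectCDiffCutModelToy4.opZon_Xi`; the header says why it is not derived).  OURS. [folklore] -/
theorem opZon_ThE₂ (hF : F.Valid) {bP : P → U} {bP' : P → V} (hω₁ : 0 ≤ ω₁)
    (hmod₂ : ∀ l e e', dE e e' ≤ ℓ e → |θs l e - θs l e'| ≤ ω₁ * (F.sc (ys e) ^ 2)⁻¹ * dE e e')
    (hzone₂ : ∀ l e e', dE e e' ≤ ℓ e → θs l e ≠ θs l e' → F.β (ys e) = 0) (hb : Bonds F ys dE ℓ sp tb r R)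
    (hbP : ∀ p, pU (bP p) = ys (sp p)) (hbP' : ∀ p, F.ρ (ys (sp p)) (pV (bP' p)) ≤ R₀) (k l : K) :
    OpZon F bP bP' pU pV (-2) (ω₁ * r * Real.exp (F.δ₀ * R₀)) (ThE sp (tb k) (θs l)) := by
  rw [ThE]
  refine opZon_diagonal hF (mul_nonneg hω₁ hb.r_nonneg) hbP (fun p _ => hbP' p) (fun p _ => ?_)
    fun p hp => (bond_zone (hzone₂ l) hb (sub_ne_zero.1 hp)).1
  rw [← weight₂_eq]
  exact (bond_abs_le (hmod₂ l) (fun e => mul_nonneg hω₁ (inv_nonneg.2 (pow_nonneg (hF.hsc _).le 2))) hb k p).1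

omit [Fintype b] [DecidableEq b] [Fintype K] [DecidableEq K] in
/-- `T′_k·Θ_k(h) ∈ 𝒵(−1, m·c_{T′}·ω₀r·e^{δ₀(R+R₀)})`: the bond differences read AT THE TARGET through the support
of `T′_k` (carried `(xb, tb_k)`); plaquette columns within `R₀` of the base site. [folklore] -/
theorem opZon_T'_mul_ThE (hF : F.Valid) {bb : b → U} {bP' : P → V} (hω₀ : 0 ≤ ω₀)
    (hmod : ∀ e e', dE e e' ≤ ℓ e → |h e - h e'| ≤ ω₀ * (F.sc (ys e))⁻¹ * dE e e')
    (hzone : ∀ e e', dE e e' ≤ ℓ e → h e ≠ h e' → F.β (ys e) = 0) (hb : Bonds F ys dE ℓ sp tb r R)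
    (hbb : ∀ a, pU (bb a) = ys (xb a)) (hbP' : ∀ p, F.ρ (ys (sp p)) (pV (bP' p)) ≤ R₀) {k : K}
    (hT' : IsCarried xb (tb k) (T' k)) (tT' : IsTab m cT' (T' k)) (hcT' : 0 ≤ cT') :
    OpZon F bb bP' pU pV (-1) (m * (cT' * (ω₀ * r)) * Real.exp (F.δ₀ * (R + R₀))) (T' k * ThE sp (tb k) h) := by
  rw [ThE]
  refine opZon_mul_diagonal hF tT' hcT' (mul_nonneg hω₀ hb.r_nonneg) hbb (fun a p hap => ?_)
    (fun a p hap hp => ?_) fun a p hap _ => ?_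
  · rw [hT' a p hap, ← weight₁_eq]
    exact (bond_abs_le hmod (fun e => mul_nonneg hω₀ (inv_nonneg.2 (hF.hsc _).le)) hb k p).2
  · rw [hT' a p hap]; exact (bond_zone hzone hb (sub_ne_zero.1 hp)).2
  · rw [hT' a p hap]
    exact (hF.hρ.triangle _ (ys (sp p)) _).trans (add_le_add (hb.frm' hF k p) (hbP' p))

omit [Fintype b] [DecidableEq b] [Fintype K] [DecidableEq K] in
/-- `J′_k·Θ_l(h) ∈ 𝒵(−1, m·c_{J′}·ω₀r·e^{δ₀(R+R₀)})`: the bond differences read AT THE SOURCE through the support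
of `J′_k` (carried `(xb, sp)`). [folklore] -/
theorem opZon_J'_mul_ThE (hF : F.Valid) {bb : b → U} {bP' : P → V} (hω₀ : 0 ≤ ω₀)
    (hmod : ∀ e e', dE e e' ≤ ℓ e → |h e - h e'| ≤ ω₀ * (F.sc (ys e))⁻¹ * dE e e')
    (hzone : ∀ e e', dE e e' ≤ ℓ e → h e ≠ h e' → F.β (ys e) = 0) (hb : Bonds F ys dE ℓ sp tb r R)
    (hbb : ∀ a, pU (bb a) = ys (xb a)) (hbP' : ∀ p, F.ρ (ys (sp p)) (pV (bP' p)) ≤ R₀) {k : K}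
    (hJ' : IsCarried xb sp (J' k)) (tJ' : IsTab m cJ' (J' k)) (hcJ' : 0 ≤ cJ') (l : K) :
    OpZon F bb bP' pU pV (-1) (m * (cJ' * (ω₀ * r)) * Real.exp (F.δ₀ * (R + R₀))) (J' k * ThE sp (tb l) h) := by
  rw [ThE]
  refine opZon_mul_diagonal hF tJ' hcJ' (mul_nonneg hω₀ hb.r_nonneg) hbb (fun a p hap => ?_)
    (fun a p hap hp => ?_) fun a p hap _ => ?_
  · rw [hJ' a p hap, ← weight₁_eq]
    exact (bond_abs_le hmod (fun e => mul_nonneg hω₀ (inv_nonneg.2 (hF.hsc _).le)) hb l p).1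
  · rw [hJ' a p hap]; exact (bond_zone hzone hb (sub_ne_zero.1 hp)).1
  · rw [hJ' a p hap]
    have h0 : 0 ≤ R := hb.R_nonneg
    linarith [hbP' p]

omit [Fintype b] [DecidableEq b] [DecidableEq K] in
/-- `LmD` is the spread over the pair index `l` of `Σ_k (T′_kΘ_k + J′_kΘ_l)`. [folklore] -/
theorem LmD_eq_spread (sp : P → E) (tb : K → P → E) (T' J' : K → Matrix b P ℝ) (h : E → ℝ) :
    LmD sp tb T' J' h = spread fun l => ∑ k, (T' k * ThE sp (tb k) h + J' k * ThE sp (tb l) h) := rfl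

/-- the constant of `LmD`: `|K|²·m·(c_{T′} + c_{J′})·ω₀r·e^{δ₀(R+R₀)}` (unoptimised). OURS (typing). [folklore] -/
def thLmD (F : Frame S) (nK m : ℕ) (cT' cJ' ω₀ r R R₀ : ℝ) : ℝ :=
  nK * (nK * (m * (cT' * (ω₀ * r)) * Real.exp (F.δ₀ * (R + R₀)) +
    m * (cJ' * (ω₀ * r)) * Real.exp (F.δ₀ * (R + R₀))))

omit [Fintype b] [DecidableEq b] [DecidableEq K] in
/-- **`LmD ∈ 𝒵(−1, thLmD)`** — the coefficient of the first covariant differences `Dv₂` in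
`B9SectCLatticeCurl.hΛ_shape` is a FIRST-ORDER zone-class operator: rows over the bond sites exactly, the column
block of `(l, p)` within frame distance `R₀` of the site of `sp p`, for `(m, c)`-tables `T′_k, J′_k` with the
supports of that file. OURS. [folklore] -/
theorem opZon_LmD (hF : F.Valid) {bb : b → U} {bq : K × P → V} (hω₀ : 0 ≤ ω₀)
    (hmod : ∀ e e', dE e e' ≤ ℓ e → |h e - h e'| ≤ ω₀ * (F.sc (ys e))⁻¹ * dE e e')
    (hzone : ∀ e e', dE e e' ≤ ℓ e → h e ≠ h e' → F.β (ys e) = 0) (hb : Bonds F ys dE ℓ sp tb r R)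
    (hbb : ∀ a, pU (bb a) = ys (xb a)) (hbq : ∀ l p, F.ρ (ys (sp p)) (pV (bq (l, p))) ≤ R₀)
    (hT' : ∀ k, IsCarried xb (tb k) (T' k)) (hJ' : ∀ k, IsCarried xb sp (J' k))
    (tT' : ∀ k, IsTab m cT' (T' k)) (tJ' : ∀ k, IsTab m cJ' (J' k)) (hcT' : 0 ≤ cT') (hcJ' : 0 ≤ cJ') :
    OpZon F bb bq pU pV (-1) (thLmD F (Fintype.card K) m cT' cJ' ω₀ r R R₀) (LmD sp tb T' J' h) := by
  rw [LmD_eq_spread]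
  exact opZon_spread fun l => opZon_sum_const fun k => B9SectCDiffDict.opZon_add
    (opZon_T'_mul_ThE hF hω₀ hmod hzone hb hbb (fun p => hbq l p) (hT' k) (tT' k) hcT')
    (opZon_J'_mul_ThE hF hω₀ hmod hzone hb hbb (fun p => hbq l p) (hJ' k) (tJ' k) hcJ' l)

omit [Fintype b] [Fintype K] [DecidableEq K] in
/-- `LmH` is a double spread of the diagonals `diagonal (θ_l ∘ xb)`. [folklore] -/
theorem LmH_eq_spread (xb : b → E) (θs : K → E → ℝ) :
    LmH xb θs = spread fun _k : K => spread fun l : K => Matrix.diagonal (θs l ∘ xb) := by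
  ext a q
  rw [spread_apply, spread_apply, Matrix.diagonal_apply, LmH, Matrix.of_apply, Function.comp_apply]
  by_cases hq : q.2.2 = a
  · rw [if_pos hq, if_pos hq.symm]
  · rw [if_neg hq, if_neg fun h' => hq h'.symm]

omit [DecidableEq K] in
/-- **`LmH ∈ 𝒵(−1, |K|²·ω₀r·e^{δ₀R₀})`** — the coefficient of the two-step tables `Hv`: entries `θ_l(xb a)`, GIVEN
that the difference quotients are `≤ ω₀r·sc⁻¹` at every position and vanish off the zone sites (`hθb`, `hθz`: on a
lattice where every position is a plaquette base these are the bond facts of §2; in general they are the natural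
global form of the direction device). OURS. [folklore] -/
theorem opZon_LmH (hF : F.Valid) {bb : b → U} {bq : K × K × b → V} (hω₀ : 0 ≤ ω₀) (hr : 0 ≤ r)
    (hθb : ∀ l e, |θs l e| ≤ ω₀ * r * (F.sc (ys e))⁻¹) (hθz : ∀ l e, θs l e ≠ 0 → F.β (ys e) = 0)
    (hbb : ∀ a, pU (bb a) = ys (xb a)) (hbq : ∀ k l a, F.ρ (ys (xb a)) (pV (bq (k, l, a))) ≤ R₀) :
    OpZon F bb bq pU pV (-1) (Fintype.card K * (Fintype.card K * (ω₀ * r * Real.exp (F.δ₀ * R₀))))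
      (LmH xb θs) := by
  rw [LmH_eq_spread]
  refine opZon_spread fun k => opZon_spread fun l => ?_
  refine opZon_diagonal hF (mul_nonneg hω₀ hr) hbb (fun a _ => hbq k l a) (fun a _ => ?_) fun a ha => hθz l _ ha
  rw [Function.comp_apply, zpow_neg_one]; exact hθb l (xb a)

variable {I : Type*} [Fintype I] {τ : I → b → E} {r' R' : ℝ}

omit [Fintype b] [Fintype I] in
/-- `LmN` is the spread of the diagonals of the (negated) hop differences. [folklore] -/
theorem LmN_eq_spread (xb : b → E) (τ : I → b → E) (h : E → ℝ) :
    LmN xb τ h = spread fun j => Matrix.diagonal fun a => -(h (τ j a) - h (xb a)) := by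
  ext a q
  rw [spread_apply, Matrix.diagonal_apply, LmN, Matrix.of_apply]
  by_cases hq : q.2 = a
  · rw [if_pos hq, if_pos hq.symm]
  · rw [if_neg hq, if_neg fun h' => hq h'.symm]

/-- **`LmN ∈ 𝒵(−1, |I|·ω₀r′·e^{δ₀R₀})`** — the coefficient of the carried perturbation parts `Nv`: first differences
of `h` over the hops `xb a → τ_j a` (a `Bonds` datum for the hops, lengths `r′`, `R′`). OURS. [folklore] -/
theorem opZon_LmN (hF : F.Valid) {bb : b → U} {bq : I × b → V} (hω₀ : 0 ≤ ω₀)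
    (hmod : ∀ e e', dE e e' ≤ ℓ e → |h e - h e'| ≤ ω₀ * (F.sc (ys e))⁻¹ * dE e e')
    (hzone : ∀ e e', dE e e' ≤ ℓ e → h e ≠ h e' → F.β (ys e) = 0) (hτ : Bonds F ys dE ℓ xb τ r' R')
    (hbb : ∀ a, pU (bb a) = ys (xb a)) (hbq : ∀ j a, F.ρ (ys (xb a)) (pV (bq (j, a))) ≤ R₀) :
    OpZon F bb bq pU pV (-1) (Fintype.card I * (ω₀ * r' * Real.exp (F.δ₀ * R₀))) (LmN xb τ h) := by
  rw [LmN_eq_spread]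
  refine opZon_spread fun j => ?_
  refine opZon_diagonal hF (mul_nonneg hω₀ hτ.r_nonneg) hbb (fun a _ => hbq j a) (fun a _ => ?_) fun a ha => ?_
  · rw [abs_neg, ← weight₁_eq]
    exact (bond_abs_le hmod (fun e => mul_nonneg hω₀ (inv_nonneg.2 (hF.hsc _).le)) hτ j a).1
  · rw [neg_ne_zero, sub_ne_zero] at ha
    exact (bond_zone hzone hτ ha).1


/-! ### §3c The total first-order coefficient `Lm₁ = [LmD ∣ LmH ∣ LmN]` -/

omit [DecidableEq K] in
/-- **`Lm₁ = [LmD ∣ LmH ∣ LmN] ∈ 𝒵(−1, thLmD + thLmH + thLmN)`** — the total coefficient of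
`B9SectCLatticeCurl.hΛ_shape_parts` on the stacked carrier, column block map `Sum.elim (Sum.elim bqD bqH) bqN`.
OURS. [folklore] -/
theorem opZon_Lm₁ {bb : b → U} {bqD : K × P → V} {bqH : K × K × b → V} {bqN : I × b → V} {θD θH θN : ℝ}
    (hD : OpZon F bb bqD pU pV (-1) θD (LmD sp tb T' J' h)) (hH : OpZon F bb bqH pU pV (-1) θH (LmH xb θs))
    (hN : OpZon F bb bqN pU pV (-1) θN (LmN xb τ h)) :
    OpZon F bb (Sum.elim (Sum.elim bqD bqH) bqN) pU pV (-1) (θD + θH + θN)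
      (Matrix.fromCols (Matrix.fromCols (LmD sp tb T' J' h) (LmH xb θs)) (LmN xb τ h)) :=
  opZon_fromCols (opZon_fromCols hD hH) hN

/-! ### §3b The second-order remainder `Lm₀ = Σ_kΣ_l T′_k·Θ_k(θ_l)·T_l` -/

/-- the constant of `Lm₀`: `|K|²·m²·(m·c_{T′}·ω₁r·c_T)·e^{δ₀(2R+R₀)}` (unoptimised). OURS (typing). [folklore] -/
def thLm₀ (F : Frame S) (nK m : ℕ) (cT' cT ω₁ r R R₀ : ℝ) : ℝ :=
  nK * (nK * ((m * m : ℕ) * (m * (cT' * (ω₁ * r) * cT)) * Real.exp (F.δ₀ * (2 * R + R₀))))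

omit [DecidableEq b] [DecidableEq K] in
/-- **`Lm₀ ∈ 𝒵(−2, thLm₀)`** — the remainder of `B9SectCLatticeCurl.hΛ_shape` is a SECOND-ORDER zone-class
operator, GIVEN the second-order cutoff facts for the difference quotients `θ_l` (`hmod₂`, `hzone₂`), for
`(m, c)`-tables `T′_k` (carried `(xb, tb_k)`) and `T_l` (carried `(tb_l, xb)`); bond rows exactly, bond columns
within `R₀`. OURS. [folklore] -/
theorem opZon_Lm₀ (hF : F.Valid) {bb : b → U} {bb' : b → V} (hω₁ : 0 ≤ ω₁)
    (hmod₂ : ∀ l e e', dE e e' ≤ ℓ e → |θs l e - θs l e'| ≤ ω₁ * (F.sc (ys e) ^ 2)⁻¹ * dE e e')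
    (hzone₂ : ∀ l e e', dE e e' ≤ ℓ e → θs l e ≠ θs l e' → F.β (ys e) = 0) (hb : Bonds F ys dE ℓ sp tb r R)
    (hbb : ∀ a, pU (bb a) = ys (xb a)) (hbb' : ∀ a, F.ρ (ys (xb a)) (pV (bb' a)) ≤ R₀)
    (hT : ∀ k, IsCarried (tb k) xb (T k)) (hT' : ∀ k, IsCarried xb (tb k) (T' k))
    (tT : ∀ k, IsTab m cT (T k)) (tT' : ∀ k, IsTab m cT' (T' k)) (hcT : 0 ≤ cT) (hcT' : 0 ≤ cT') :
    OpZon F bb bb' pU pV (-2) (thLm₀ F (Fintype.card K) m cT' cT ω₁ r R R₀) (Lm₀ sp tb θs T T') := by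
  rw [Lm₀]
  refine opZon_sum_const fun k => opZon_sum_const fun l => ?_
  rw [ThE]
  refine opZon_sandwich hF (tT' k) (tT l) hcT' hcT (mul_nonneg hω₁ hb.r_nonneg) hbb (fun a p hap => ?_)
    (fun a p hap hp => ?_) fun a p c hap hpc => ?_
  · rw [hT' k a p hap, ← weight₂_eq]
    exact (bond_abs_le (hmod₂ l) (fun e => mul_nonneg hω₁ (inv_nonneg.2 (pow_nonneg (hF.hsc _).le 2)))
      hb k p).2
  · rw [hT' k a p hap]; exact (bond_zone (hzone₂ l) hb (sub_ne_zero.1 hp)).2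
  · rw [hT' k a p hap]
    calc F.ρ (ys (tb k p)) (pV (bb' c)) ≤ F.ρ (ys (tb k p)) (ys (tb l p)) + F.ρ (ys (tb l p)) (pV (bb' c)) :=
          hF.hρ.triangle _ _ _
      _ ≤ 2 * R + R₀ := add_le_add (hb.frm₂ hF k l p) (by rw [hT l p c hpc]; exact hbb' c)

end Pairs

/-! ## §4 One pair with directions: `Dm₁`, `Dm₀`, `Am₁`, `Am₀` of `B9SectCLatticeCalc` -/

section OnePair

variable {S E s b Δ U V : Type*} [Fintype s] [Fintype b] [DecidableEq s] [DecidableEq b] [Fintype Δ]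
  [DecidableEq Δ] [DecidableEq V]
variable {F : Frame S} {ys : E → S} {dE : E → E → ℝ} {ℓ : E → ℝ} {h θ : E → ℝ} {θs : Δ → E → ℝ}
  {ω₀ ω₁ r R R₀ cT cJ cT' cJ' : ℝ} {m : ℕ}
variable {xs : s → E} {sb tb : b → E} {T J : Matrix b s ℝ} {T' J' : Matrix s b ℝ} (dir : b → Δ)
variable {pU : U → S} {pV : V → S}

omit [Fintype b] [Fintype Δ] [DecidableEq Δ] in
/-- `Dm₁` is the spread of the diagonals `diagonal (θ_μ ∘ sb)`. [folklore] -/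
theorem Dm₁_eq_spread (sb : b → E) (θs : Δ → E → ℝ) :
    Dm₁ sb θs = spread fun μ => Matrix.diagonal (θs μ ∘ sb) := by
  ext a q
  rw [spread_apply, Matrix.diagonal_apply, Dm₁, Matrix.of_apply, Function.comp_apply]
  by_cases hq : q.2 = a
  · rw [if_pos hq, if_pos hq.symm]
  · rw [if_neg hq, if_neg fun h' => hq h'.symm]

omit [DecidableEq Δ] in
/-- **`Dm₁ ∈ 𝒵(−1, |Δ|·ω₀r·e^{δ₀R₀})`** — the coefficient of `B9SectCLatticeCalc.hM_shape`: entries `θ_μ(sb a)`,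
given the global first-order facts `hθb`, `hθz` for the difference quotients (as for `opZon_LmH`). OURS.
[folklore] -/
theorem opZon_Dm₁ (hF : F.Valid) {bb : b → U} {bq : Δ × b → V} (hω₀ : 0 ≤ ω₀) (hr : 0 ≤ r)
    (hθb : ∀ μ e, |θs μ e| ≤ ω₀ * r * (F.sc (ys e))⁻¹) (hθz : ∀ μ e, θs μ e ≠ 0 → F.β (ys e) = 0)
    (hbb : ∀ a, pU (bb a) = ys (sb a)) (hbq : ∀ μ a, F.ρ (ys (sb a)) (pV (bq (μ, a))) ≤ R₀) :
    OpZon F bb bq pU pV (-1) (Fintype.card Δ * (ω₀ * r * Real.exp (F.δ₀ * R₀))) (Dm₁ sb θs) := by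
  rw [Dm₁_eq_spread]
  refine opZon_spread fun μ => ?_
  refine opZon_diagonal hF (mul_nonneg hω₀ hr) hbb (fun a _ => hbq μ a) (fun a _ => ?_) fun a ha => hθz μ _ ha
  rw [Function.comp_apply, zpow_neg_one]; exact hθb μ (sb a)

/-- the constant of `Dm₀`: `|Δ|·m²·(ω₁r·m·c_T·c_{T′})·e^{δ₀(2R+R₀)}` (unoptimised). OURS (typing). [folklore] -/
def thDm₀ (F : Frame S) (nΔ m : ℕ) (cT cT' ω₁ r R R₀ : ℝ) : ℝ :=
  nΔ * ((m * m : ℕ) * (ω₁ * r * (m * (cT * cT'))) * Real.exp (F.δ₀ * (2 * R + R₀)))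

/-- **`Dm₀ ∈ 𝒵(−2, thDm₀)`** — the remainder of `B9SectCLatticeCalc.hM_shape`, `Σ_μ Θ_(θ_μ)·(T·T′_μ)`, is
SECOND ORDER given the second-order cutoff facts for the `θ_μ`; bonds carry the source position `sb` (the bond
geometry is the one-pair `Bonds` datum, pair index `Unit`). OURS. [folklore] -/
theorem opZon_Dm₀ (hF : F.Valid) {bb : b → U} {bb' : b → V} (hω₁ : 0 ≤ ω₁)
    (hmod₂ : ∀ μ e e', dE e e' ≤ ℓ e → |θs μ e - θs μ e'| ≤ ω₁ * (F.sc (ys e) ^ 2)⁻¹ * dE e e')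
    (hzone₂ : ∀ μ e e', dE e e' ≤ ℓ e → θs μ e ≠ θs μ e' → F.β (ys e) = 0)
    (hb : Bonds F ys dE ℓ sb (fun _ : Unit => tb) r R)
    (hbb : ∀ a, pU (bb a) = ys (sb a)) (hbb' : ∀ a, F.ρ (ys (sb a)) (pV (bb' a)) ≤ R₀)
    (hT : IsCarried tb xs T) (hT' : IsCarried xs tb T') (tT : IsTab m cT T) (tT' : IsTab m cT' T')
    (hcT : 0 ≤ cT) (hcT' : 0 ≤ cT') :
    OpZon F bb bb' pU pV (-2) (thDm₀ F (Fintype.card Δ) m cT cT' ω₁ r R R₀) (Dm₀ dir sb tb θs T T') := by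
  rw [Dm₀]
  refine opZon_sum_const fun μ => ?_
  rw [ThE]
  refine opZon_diagonal_mul hF (tT.mul (tT'.dpart dir μ hcT') hcT hcT') (by positivity)
    (mul_nonneg hω₁ hb.r_nonneg) hbb (fun a _ => ?_)
    (fun a ha => (bond_zone (hzone₂ μ) hb (k := ()) (sub_ne_zero.1 ha)).1) fun a c _ hac => ?_
  · rw [← weight₂_eq]
    exact (bond_abs_le (hmod₂ μ) (fun e => mul_nonneg hω₁ (inv_nonneg.2 (pow_nonneg (hF.hsc _).le 2)))
      hb () a).1
  · obtain ⟨v, hav, hvc⟩ := exists_of_mul_ne_zero hac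
    have hvc' : T' v c ≠ 0 := by
      rw [dpart_apply] at hvc
      by_cases hd : dir c = μ
      · rwa [if_pos hd] at hvc
      · exact absurd (if_neg hd) hvc
    have e1 : tb a = tb c := (hT a v hav).trans (hT' v c hvc')
    calc F.ρ (ys (sb a)) (pV (bb' c))
        ≤ F.ρ (ys (sb a)) (ys (tb a)) + F.ρ (ys (tb a)) (pV (bb' c)) := hF.hρ.triangle _ _ _
      _ ≤ R + (F.ρ (ys (tb c)) (ys (sb c)) + F.ρ (ys (sb c)) (pV (bb' c))) := by
          rw [e1]; exact add_le_add (hb.frm () a |>.trans_eq' (by rw [e1])) (hF.hρ.triangle _ _ _)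
      _ ≤ R + (R + R₀) := by
          refine add_le_add le_rfl (add_le_add (hb.frm' hF () c) (hbb' c))
      _ = 2 * R + R₀ := by ring

omit [Fintype s] [DecidableEq s] in
/-- **`Am₁ = J′Θ_h + T′Θ_h ∈ 𝒵(−1, ·)`** — the coefficient of `B9SectCLatticeCalc.hA_shape`: site rows exactly
(`hbs`), bond columns within `R₀` of the source site; the bond differences read through `J′` (carried `(xs, sb)`) at
the source and through `T′` (carried `(xs, tb)`) at the target. OURS. [folklore] -/
theorem opZon_Am₁ (hF : F.Valid) {bs : s → U} {bb' : b → V} (hω₀ : 0 ≤ ω₀)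
    (hmod : ∀ e e', dE e e' ≤ ℓ e → |h e - h e'| ≤ ω₀ * (F.sc (ys e))⁻¹ * dE e e')
    (hzone : ∀ e e', dE e e' ≤ ℓ e → h e ≠ h e' → F.β (ys e) = 0)
    (hb : Bonds F ys dE ℓ sb (fun _ : Unit => tb) r R)
    (hbs : ∀ v, pU (bs v) = ys (xs v)) (hbb' : ∀ a, F.ρ (ys (sb a)) (pV (bb' a)) ≤ R₀)
    (hT' : IsCarried xs tb T') (hJ' : IsCarried xs sb J') (tT' : IsTab m cT' T') (tJ' : IsTab m cJ' J')
    (hcT' : 0 ≤ cT') (hcJ' : 0 ≤ cJ') :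
    OpZon F bs bb' pU pV (-1)
      (m * (cJ' * (ω₀ * r)) * Real.exp (F.δ₀ * (R + R₀)) + m * (cT' * (ω₀ * r)) * Real.exp (F.δ₀ * (R + R₀)))
      (J' * ThE sb tb h + T' * ThE sb tb h) := by
  have hwt : ∀ e, 0 ≤ ω₀ * (F.sc (ys e))⁻¹ := fun e => mul_nonneg hω₀ (inv_nonneg.2 (hF.hsc _).le)
  rw [ThE]
  refine B9SectCDiffDict.opZon_add ?_ ?_
  · refine opZon_mul_diagonal hF tJ' hcJ' (mul_nonneg hω₀ hb.r_nonneg) hbs (fun v c hvc => ?_)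
      (fun v c hvc hc => ?_) fun v c hvc _ => ?_
    · rw [hJ' v c hvc, ← weight₁_eq]; exact (bond_abs_le hmod hwt hb () c).1
    · rw [hJ' v c hvc]; exact (bond_zone hzone hb (k := ()) (sub_ne_zero.1 hc)).1
    · rw [hJ' v c hvc]; have h0 := hb.R_nonneg; linarith [hbb' c]
  · refine opZon_mul_diagonal hF tT' hcT' (mul_nonneg hω₀ hb.r_nonneg) hbs (fun v c hvc => ?_)
      (fun v c hvc hc => ?_) fun v c hvc _ => ?_
    · rw [hT' v c hvc, ← weight₁_eq]; exact (bond_abs_le hmod hwt hb () c).2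
    · rw [hT' v c hvc]; exact (bond_zone hzone hb (k := ()) (sub_ne_zero.1 hc)).2
    · rw [hT' v c hvc]
      exact (hF.hρ.triangle _ (ys (sb c)) _).trans (add_le_add (hb.frm' hF () c) (hbb' c))

/-- **THE HONEST HALF OF `Am₀`**: the first-difference × DEFECT term of `B9SectCLatticeCurl.am₀_exchange` VANISHES
when the difference quotient `θ` is zero at every site carrying a row of the `h`-free defect table `J′J − T′T`
("`h` constant near defective positions": boundary deletions, unmatched weights, non-orthogonal transporters —
the `h₄` pattern of `B9SectCDiffCutModelToy4`, where `θ_h` vanishes at the first site). [folklore] -/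
theorem defect_term_eq_zero {H : Matrix s s ℝ} (hdef : ∀ v v', H v v' ≠ 0 → θ (xs v) = 0) :
    Matrix.diagonal (θ ∘ xs) * H = 0 := by
  ext v v'
  rw [Matrix.diagonal_mul, Matrix.zero_apply, Function.comp_apply]
  by_cases hH : H v v' = 0
  · rw [hH, mul_zero]
  · rw [hdef v v' hH, zero_mul]

/-- **`Am₀ ∈ 𝒵(−2, m²·(m·c_{T′}·ω₁r·c_T)·e^{δ₀R₀})` UNDER THE DEFECT HYPOTHESIS** `hdef` (and the second-order
cutoff facts for the difference quotient `θ` of the device `hθ`): by `am₀_exchange` the remainder of the `hA` shape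
is then `T′·Θ_θ·T` alone, a sandwich of SECOND differences.  Without `hdef` only the first-order class of
`opZon_Am₀_defect` is available for the defect term — the order claim is CONDITIONAL, the identity is not. OURS.
[folklore] -/
theorem opZon_Am₀ (hF : F.Valid) {bs : s → U} {bs' : s → V} (hω₁ : 0 ≤ ω₁)
    (hmodθ : ∀ e e', dE e e' ≤ ℓ e → |θ e - θ e'| ≤ ω₁ * (F.sc (ys e) ^ 2)⁻¹ * dE e e')
    (hzoneθ : ∀ e e', dE e e' ≤ ℓ e → θ e ≠ θ e' → F.β (ys e) = 0)
    (hb : Bonds F ys dE ℓ sb (fun _ : Unit => tb) r R) (hθ : ∀ c, θ (sb c) = h (tb c) - h (sb c))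
    (hbs : ∀ v, pU (bs v) = ys (xs v)) (hbs' : ∀ v, F.ρ (ys (xs v)) (pV (bs' v)) ≤ R₀)
    (hT : IsCarried tb xs T) (hT' : IsCarried xs tb T') (hJ' : IsCarried xs sb J') (tT : IsTab m cT T)
    (tT' : IsTab m cT' T') (hcT : 0 ≤ cT) (hcT' : 0 ≤ cT')
    (hdef : ∀ v v', (J' * J - T' * T) v v' ≠ 0 → θ (xs v) = 0) :
    OpZon F bs bs' pU pV (-2) ((m * m : ℕ) * (m * (cT' * (ω₁ * r) * cT)) * Real.exp (F.δ₀ * R₀))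
      (J' * ThE sb tb h * J - T' * ThE sb tb h * T) := by
  rw [B9SectCLatticeCurl.am₀_exchange hT' hJ' hθ, defect_term_eq_zero hdef, zero_add, ThE]
  refine opZon_sandwich hF tT' tT hcT' hcT (mul_nonneg hω₁ hb.r_nonneg) hbs (fun v c hvc => ?_)
    (fun v c hvc hc => ?_) fun v c v' hvc hcv => ?_
  · rw [hT' v c hvc, ← weight₂_eq]
    exact (bond_abs_le hmodθ (fun e => mul_nonneg hω₁ (inv_nonneg.2 (pow_nonneg (hF.hsc _).le 2))) hb () c).2
  · rw [hT' v c hvc]; exact (bond_zone hzoneθ hb (k := ()) (sub_ne_zero.1 hc)).2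
  · rw [hT' v c hvc, hT c v' hcv]; exact (hbs' v').trans_eq' (by rw [← hT c v' hcv])

/-- the defect term in general: FIRST order only — `diagonal (θ ∘ xs)·H ∈ 𝒵(−1, m_H·ω₀r·c_H·e^{δ₀R_H})` for an
`(m_H, c_H)`-table `H` whose columns are within frame distance `R_H` of its row sites (honest complement of
`opZon_Am₀`). OURS. [folklore] -/
theorem opZon_Am₀_defect (hF : F.Valid) {bs : s → U} {bs' : s → V} {H : Matrix s s ℝ} {mH : ℕ} {cH RH : ℝ}
    (hω₀ : 0 ≤ ω₀) (hr : 0 ≤ r) (hθb : ∀ e, |θ e| ≤ ω₀ * r * (F.sc (ys e))⁻¹)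
    (hθz : ∀ e, θ e ≠ 0 → F.β (ys e) = 0) (hbs : ∀ v, pU (bs v) = ys (xs v)) (tH : IsTab mH cH H)
    (hcH : 0 ≤ cH) (hRH : ∀ v v', H v v' ≠ 0 → F.ρ (ys (xs v)) (pV (bs' v')) ≤ RH) :
    OpZon F bs bs' pU pV (-1) (mH * (ω₀ * r * cH) * Real.exp (F.δ₀ * RH)) (Matrix.diagonal (θ ∘ xs) * H) :=
  opZon_diagonal_mul hF tH hcH (mul_nonneg hω₀ hr) hbs
    (fun v _ => by rw [Function.comp_apply, zpow_neg_one]; exact hθb (xs v)) (fun v hv => hθz _ hv)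
    fun v v' _ hH => hRH v v' hH

end OnePair

/-! ## §5 (H) The starred operator as a weighted adjoint: supports and tables follow -/

section Adjoint

variable {u v : Type*} [Fintype u] [Fintype v] [DecidableEq u] [DecidableEq v]

omit [Fintype v] [DecidableEq u] [DecidableEq v] in
/-- a table from COLUMN counts: `Aᵀ` is an `(m′, c)`-table when every column of `A` has `≤ m′` non-zero entries.
[folklore] -/
theorem IsTab.transpose_of_cols {A : Matrix u v ℝ} {m' : ℕ} {c : ℝ}
    (hcol : ∀ y, (univ.filter fun x => A x y ≠ 0).card ≤ m') (hs : ∀ x y, |A x y| ≤ c) :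
    IsTab m' c A.transpose where
  count y := by
    have e : (univ.filter fun x => A.transpose y x ≠ 0) = univ.filter fun x => A x y ≠ 0 := by
      ext x; simp only [mem_filter, Matrix.transpose_apply]
    rw [e]; exact hcol y
  size y x := hs x y

/-- **THE WEIGHTED ADJOINT IS A TABLE**: `diagonal w′·Aᵀ·diagonal w` is an `(m′, W′·c·W)`-table from the column
count of `A` and bounds on the weights. [folklore] -/
theorem IsTab.wadjoint {A : Matrix u v ℝ} {m' : ℕ} {c W W' : ℝ} {w : u → ℝ} {w' : v → ℝ}
    (hcol : ∀ y, (univ.filter fun x => A x y ≠ 0).card ≤ m') (hs : ∀ x y, |A x y| ≤ c) (hc : 0 ≤ c)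
    (hW' : ∀ y, |w' y| ≤ W') (hW : ∀ x, |w x| ≤ W) (hW'0 : 0 ≤ W') :
    IsTab m' (W' * c * W) (Matrix.diagonal w' * A.transpose * Matrix.diagonal w) :=
  (IsTab.transpose_of_cols hcol hs).of_support
    (fun y x h => by
      rw [Matrix.mul_diagonal, Matrix.diagonal_mul] at h
      exact right_ne_zero_of_mul (left_ne_zero_of_mul h))
    fun y x => by
      rw [Matrix.mul_diagonal, Matrix.diagonal_mul, Matrix.transpose_apply, abs_mul, abs_mul]
      exact mul_le_mul (mul_le_mul (hW' y) (hs x y) (abs_nonneg _) hW'0) (hW x) (abs_nonneg _)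
        (mul_nonneg hW'0 hc)

end Adjoint

section AdjointPairs

variable {E b P K : Type*} [Fintype b] [Fintype P] [DecidableEq b] [DecidableEq P] [Fintype K]
variable {xb : b → E} {sp : P → E} {tb : K → P → E} {T J : K → Matrix P b ℝ}

omit [Fintype K] in
/-- **(H) SUPPORTS OF THE STARRED FAMILY FOLLOW**: with `T′_k := diagonal w′·T_kᵀ·diagonal w`,
`J′_k := diagonal w′·J_kᵀ·diagonal w` (the adjoint of the pair family for the weighted inner products
`⟨·,·⟩_b = Σ w′⁻¹…`, `⟨·,·⟩_P = Σ w…` — any positive site / bond / plaquette weights), the four support hypotheses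
`hT′`, `hJ′` of `B9SectCLatticeCurl.hΛ_shape` follow from `hT`, `hJ` (pointwise `isCarried_wadjoint`). [folklore] -/
theorem wadjoint_family_carried (hT : ∀ k, IsCarried (tb k) xb (T k)) (hJ : ∀ k, IsCarried sp xb (J k))
    (w' : b → ℝ) (w : P → ℝ) :
    (∀ k, IsCarried xb (tb k) (Matrix.diagonal w' * (T k).transpose * Matrix.diagonal w)) ∧
      ∀ k, IsCarried xb sp (Matrix.diagonal w' * (J k).transpose * Matrix.diagonal w) :=
  ⟨fun k => isCarried_wadjoint (hT k) w' w, fun k => isCarried_wadjoint (hJ k) w' w⟩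

/-- **(H) THE STARRED OPERATOR IS THE WEIGHTED ADJOINT**: `Σ_k (T′_k − J′_k) = diagonal w′·(Σ_k (T_k − J_k))ᵀ·
diagonal w` for the adjoint family — `D′` of `hΛ_shape` is literally the weighted adjoint of `D`. [folklore] -/
theorem wadjoint_family_sum (T J : K → Matrix P b ℝ) (w' : b → ℝ) (w : P → ℝ) :
    ∑ k, (Matrix.diagonal w' * (T k).transpose * Matrix.diagonal w -
        Matrix.diagonal w' * (J k).transpose * Matrix.diagonal w) =
      Matrix.diagonal w' * (∑ k, (T k - J k)).transpose * Matrix.diagonal w := by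
  rw [Matrix.transpose_sum, Matrix.mul_sum, Matrix.sum_mul]
  refine Finset.sum_congr rfl fun k _ => ?_
  rw [Matrix.transpose_sub, Matrix.mul_sub, Matrix.sub_mul]

end AdjointPairs

/-! ## §6 Sanity: the toy line of `B9SectCDiffCutModelToy4` — the constant `ω₀` of `opZon_Th` recovered -/

section Toy

open B9SectCDiffCutModelToy (dE bdist bdist_self)
open B9SectCDiffCutModelToy2 (dE_self)
open B9SectCDiffCutModelToy3 (toyFrame toyFrame_sc toyFrame_ρ toyFrame_δ₀ toyFrame_valid)
open B9SectCDiffCutModelToy4 (ι ι_lt bdist_le_one_of_succ dE_of_succ)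
open B9SectCLatticeCalc (nxt nxt_eq_of_succ nxt_eq_self)

variable {n B : ℕ} {N : Finset (Fin n)} {hN : N.Nonempty} {δ₀ : ℝ}
variable {U V : Type*} [DecidableEq V] {bu bv' : Fin n × Fin B → U} {bv : Fin n × Fin B → V}
  {pU : U → Fin n} {pV : V → Fin n}

/-- the bonds `a → nxt a` of the toy line are a `Bonds` datum with `r = R = 1` for the radius `B` and the site map
`Prod.fst`. [folklore] -/
theorem toy_bonds (hB : 0 < B) :
    Bonds (toyFrame n B N hN δ₀) Prod.fst (dE n B) (fun _ => (B : ℝ)) id (fun _ : Unit => nxt) 1 1 := by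
  have hB1 : (1 : ℝ) ≤ B := by exact_mod_cast hB
  have key : ∀ a : Fin n × Fin B, (dE n B a (nxt a) ≤ 1 ∧ dE n B (nxt a) a ≤ 1) ∧
      bdist n a.1 (nxt a).1 ≤ 1 := by
    intro a
    by_cases hk : ι a + 1 < n * B
    · obtain ⟨y, hy⟩ := B9SectCDiffCutModelToy4.exists_succ hk
      rw [nxt_eq_of_succ hy]
      exact ⟨⟨(dE_of_succ hy).1.le, (dE_of_succ hy).2.le⟩, bdist_le_one_of_succ hy⟩
    · have ha : ∀ y : Fin n × Fin B, ι y ≠ ι a + 1 := fun y hy => hk (hy ▸ ι_lt y)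
      rw [nxt_eq_self ha, dE_self, bdist_self]
      exact ⟨⟨zero_le_one, zero_le_one⟩, zero_le_one⟩
  exact { r_nonneg := zero_le_one
          R_nonneg := zero_le_one
          len_s := fun _ a => (key a).1.1
          len_t := fun _ a => (key a).1.2
          loc_s := fun _ a => (key a).1.1.trans hB1
          loc_t := fun _ a => (key a).1.2.trans hB1
          frm := fun _ a => by rw [toyFrame_ρ]; exact (key a).2 }

/-- **SANITY — `opZon_Th` RECOVERED WITH ITS CONSTANT**: on the toy frame, `opZon_ThE` applied to the bonds
`a → nxt a` (`r = 1`, columns over the same blocks so `R₀ = 0`) gives `Θ_h = ThE id nxt h ∈ 𝒵(−1, ω₀)` from the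
two cutoff facts in exactly the shapes of `B9SectCDiffCutModelToy4.opZon_Th` — the same constant `ω₀`; by
`B9SectCLatticeCalc.ThE_toy` (`ThE id nxt h = Th h`) this IS that theorem.  (The frame-length `R = 1` of the bonds
does not enter a diagonal operator.) [folklore] -/
theorem opZon_ThE_toy (hB : 0 < B) (hδ₀ : 0 < δ₀) {h : Fin n × Fin B → ℝ} {ω₀ : ℝ} (hω₀ : 0 ≤ ω₀)
    (hbu : ∀ x, pU (bu x) = x.1) (hbv : ∀ x, pV (bv x) = x.1)
    (hmod : ∀ e e', dE n B e e' ≤ (fun _ => (B : ℝ)) e →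
      |h e - h e'| ≤ ω₀ * ((toyFrame n B N hN δ₀).sc (id (Prod.fst e)))⁻¹ * dE n B e e')
    (hzone : ∀ e e', dE n B e e' ≤ (fun _ => (B : ℝ)) e → h e ≠ h e' →
      (toyFrame n B N hN δ₀).β (id (Prod.fst e)) = 0) :
    OpZon (toyFrame n B N hN δ₀) bu bv pU pV (-1) ω₀ (ThE id nxt h) := by
  have h1 := opZon_ThE (toyFrame_valid hB hN hδ₀) (ys := Prod.fst) (R₀ := 0) (bP := bu) (bP' := bv) (pU := pU)
    (pV := pV) hω₀ hmod hzone (toy_bonds hB) hbu (fun p => by rw [toyFrame_ρ, hbv, id, bdist_self]) ()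
  refine opZon_cst h1 ?_
  rw [toyFrame_δ₀, mul_zero, Real.exp_zero, mul_one, mul_one]

end Toy

end

end Literature.MathematicalPhysics.QuantumFieldTheory.Balaban1983to89.B9SectCLatticeOrder
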